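import Literature.MathematicalPhysics.QuantumLattice.LatticeGaugeDLR
import HarnessLib

/-!
# Mesh-`b` grid cells of the edges of `ℤᵈ`

Helper file for item `stmt-QuantumFields-8895` (`FiniteSizeCriterion` of route `OneCertifiedCube`,
sub-problem `YangMills`).

The block recursion (`OneCertifiedCubeFiniteSizeCriterionRecursion.lean`) reads a specification on
`ZdEdge d → S` through a cell map `cell : ZdEdge d → ℤᵈ`. Here the cell map is the mesh-`b` grid,
`cell e = (⌊e.1 i / b⌋)ᵢ` (integer floor division, `b ≥ 1`), i.e. the `[b, 2b]`-cell frame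
`w i j = b j` of the route statement with all cells of side exactly `b`:

* `ediv_eq_iff_bounds`, `mem_gridCell_iff`, `finite_gridCell` — the cell `y` is the finite edge box
  `(∏ᵢ [b yᵢ, b (yᵢ+1))) × (all directions)`;
* `abs_ediv_sub_ediv_le_one` — edges at sup-distance `≤ 1` lie in cells at sup-distance `≤ 1`;
* `gridFS_of_frameFS` — the finite-size hypothesis of `FiniteSizeCriterion` (stated for all
  `[b, 2b]`-cell frames `w`, centred at the cell of index `0`) specialised to the translated grid
  frames `w i j = b (j + xᵢ)` and rewritten in terms of the cell map: for every cell `x`, every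
  cell-union volume `Λ₀` within cell distance `2n` of `x` containing the cell `x`, exterior data
  agreeing on the cube of `(4n+1)ᵈ` cells around `x` give kernel expectations of `[0,1]`-valued
  observables of the cell `x` within `ε`.

No definition is introduced: the cell map is written as the explicit lambda
`fun e i => e.1 i / (b : ℤ)` throughout.
-/

set_option autoImplicit false

noncomputable section

open MeasureTheory
open Literature.Probability.LatticeModels
open Literature.MathematicalPhysics.QuantumLattice

namespace Summit.QuantumFields.YangMills.Theorems.FiniteSizeCriterion

/-! ## Floor division -/

/-- `a / b = z` iff `a` lies in the block `[b z, b (z+1))` (`b > 0`, floor division). -/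
theorem ediv_eq_iff_bounds {a z b : ℤ} (hb : 0 < b) : a / b = z ↔ b * z ≤ a ∧ a < b * (z + 1) := by
  constructor
  · intro h
    have h1 : z ≤ a / b := h ▸ le_rfl
    have h2 : a / b < z + 1 := h ▸ lt_add_one _
    have h1' := (Int.le_ediv_iff_mul_le hb).1 h1
    have h2' := (Int.ediv_lt_iff_lt_mul hb).1 h2
    constructor <;> linarith [mul_comm z b, mul_comm (z + 1) b]
  · rintro ⟨h1, h2⟩
    have h1' : z ≤ a / b := (Int.le_ediv_iff_mul_le hb).2 (by linarith [mul_comm z b])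
    have h2' : a / b < z + 1 := (Int.ediv_lt_iff_lt_mul hb).2 (by linarith [mul_comm (z + 1) b])
    omega

/-- Floor division by `b ≥ 1` contracts: `|a / b - a' / b| ≤ 1` when `|a - a'| ≤ 1`. -/
theorem abs_ediv_sub_ediv_le_one {b : ℤ} (hb : 0 < b) {a a' : ℤ} (h : a' - 1 ≤ a ∧ a ≤ a' + 1) :
    |a / b - a' / b| ≤ 1 := by
  have hlo : (a' - b) / b ≤ a / b := Int.ediv_le_ediv hb (by linarith)
  have hhi : a / b ≤ (a' + b) / b := Int.ediv_le_ediv hb (by linarith)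
  have e1 : (a' - b) / b = a' / b + (-1) := by
    rw [← Int.add_mul_ediv_right a' (-1) hb.ne']; ring_nf
  have e2 : (a' + b) / b = a' / b + 1 := by
    rw [← Int.add_mul_ediv_right a' 1 hb.ne']; ring_nf
  rw [abs_le]
  constructor <;> linarith

variable {d : ℕ}

/-- Edges at sup-distance `≤ 1` lie in grid cells at sup-distance `≤ 1` (hypothesis `hC1` of the
block recursion for the mesh-`b` grid). -/
theorem grid_hC1 {b : ℤ} (hb : 0 < b) (e e' : ZdEdge d)
    (h : ∀ k, e'.1 k - 1 ≤ e.1 k ∧ e.1 k ≤ e'.1 k + 1) (k : Fin d) :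
    |(fun (v : ZdEdge d) (i : Fin d) => v.1 i / b) e k -
      (fun (v : ZdEdge d) (i : Fin d) => v.1 i / b) e' k| ≤ 1 :=
  abs_ediv_sub_ediv_le_one hb (h k)

/-! ## Grid cells as finite edge boxes -/

/-- Membership in the grid cell `y` (the edge box `(∏ᵢ [b yᵢ, b(yᵢ+1))) × univ`) is having cell
label `y`. -/
theorem mem_gridCell_iff {b : ℤ} (hb : 0 < b) (y : Fin d → ℤ) (e : ZdEdge d) :
    e ∈ (Fintype.piFinset fun i => Finset.Ico (b * y i) (b * (y i + 1))) ×ˢ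
        (Finset.univ : Finset (Fin d)) ↔ (fun i => e.1 i / b) = y := by
  simp only [Finset.mem_product, Finset.mem_univ, and_true, Fintype.mem_piFinset, Finset.mem_Ico,
    funext_iff, ediv_eq_iff_bounds hb]

/-- Grid cells are finite (hypothesis `hfin` of the block recursion for the mesh-`b` grid). -/
theorem finite_gridCell {b : ℤ} (hb : 0 < b) (y : Fin d → ℤ) :
    Set.Finite {v : ZdEdge d | (fun (v : ZdEdge d) (i : Fin d) => v.1 i / b) v = y} := by
  refine (Finset.finite_toSet ((Fintype.piFinset fun i => Finset.Ico (b * y i) (b * (y i + 1))) ×ˢ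
    (Finset.univ : Finset (Fin d)))).subset fun v hv => ?_
  exact Finset.mem_coe.2 ((mem_gridCell_iff hb y v).2 hv)

/-! ## The finite-size hypothesis on grid frames -/

/-- **The finite-size hypothesis of `FiniteSizeCriterion`, read on the mesh-`b` grid.** The
hypothesis quantifies over all `[b, 2b]`-cell frames `w` of `ℤ⁴` with the cube of `(4n+1)⁴` cells
centred at the cell of index `0`; specialising to the translated grid frames `w i j = b (j + xᵢ)`
(cells of side exactly `b`, cell of index `y` = grid cell `y + x`) gives, for every grid cell `x`
and every cell-union volume `Λ₀` of grid cells within sup-distance `2n` of `x` containing the cell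
`x`: exterior data agreeing on the grid cells within distance `2n` of `x` give `γ_{Λ₀}`-expectations
of `[0,1]`-valued measurable observables of the cell `x` within `ε`. -/
theorem gridFS_of_frameFS {S : Type*} [Group S] [MeasurableSpace S] (γ : Specification (ZdEdge 4) S)
    {b n : ℕ} (hb : 1 ≤ b) {ε : ℝ}
    (hFS : ∀ w : Fin 4 → ℤ → ℤ, (∀ i j, w i j + ((b : ℕ) : ℤ) ≤ w i (j + 1) ∧
        w i (j + 1) ≤ w i j + 2 * ((b : ℕ) : ℤ)) →
      ∀ Y : Finset (Fin 4 → ℤ), Y ⊆ (Fintype.piFinset fun _ : Fin 4 =>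
        Finset.Icc (-(2 * ((n : ℕ) : ℤ))) (2 * ((n : ℕ) : ℤ))) → (0 : Fin 4 → ℤ) ∈ Y →
      ∀ η η' : LGConfig 4 S, (∀ e ∈ (Fintype.piFinset fun _ : Fin 4 =>
        Finset.Icc (-(2 * ((n : ℕ) : ℤ))) (2 * ((n : ℕ) : ℤ))).biUnion (fun y : Fin 4 → ℤ =>
          (Fintype.piFinset fun i : Fin 4 => Finset.Ico (w i (y i)) (w i (y i + 1))) ×ˢ
            (Finset.univ : Finset (Fin 4))), η e = η' e) →
      ∀ f : LGConfig 4 S → ℝ, IsCylinder f ((fun y : Fin 4 → ℤ =>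
        (Fintype.piFinset fun i : Fin 4 => Finset.Ico (w i (y i)) (w i (y i + 1))) ×ˢ
          (Finset.univ : Finset (Fin 4))) 0) → Measurable f → (∀ U, 0 ≤ f U ∧ f U ≤ 1) →
      |(∫ U, f U ∂(γ (Y.biUnion (fun y : Fin 4 → ℤ =>
          (Fintype.piFinset fun i : Fin 4 => Finset.Ico (w i (y i)) (w i (y i + 1))) ×ˢ
            (Finset.univ : Finset (Fin 4)))) η)) -
        ∫ U, f U ∂(γ (Y.biUnion (fun y : Fin 4 → ℤ =>
          (Fintype.piFinset fun i : Fin 4 => Finset.Ico (w i (y i)) (w i (y i + 1))) ×ˢ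
            (Finset.univ : Finset (Fin 4)))) η')| ≤ ε)
    (x : Fin 4 → ℤ) (Λ₀ : Finset (ZdEdge 4))
    (hunion : ∀ v w : ZdEdge 4, (fun (v : ZdEdge 4) (i : Fin 4) => v.1 i / (b : ℤ)) v =
      (fun (v : ZdEdge 4) (i : Fin 4) => v.1 i / (b : ℤ)) w → v ∈ Λ₀ → w ∈ Λ₀)
    (hnear : ∀ v ∈ Λ₀, ∀ i, |(fun (v : ZdEdge 4) (i : Fin 4) => v.1 i / (b : ℤ)) v i - x i| ≤ 2 * n)
    (hx : ∀ v : ZdEdge 4, (fun (v : ZdEdge 4) (i : Fin 4) => v.1 i / (b : ℤ)) v = x → v ∈ Λ₀)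
    (η η' : LGConfig 4 S)
    (hagree : ∀ v : ZdEdge 4,
      (∀ i, |(fun (v : ZdEdge 4) (i : Fin 4) => v.1 i / (b : ℤ)) v i - x i| ≤ 2 * n) → η v = η' v)
    (f : LGConfig 4 S → ℝ)
    (hfdep : DependsOn f {v | (fun (v : ZdEdge 4) (i : Fin 4) => v.1 i / (b : ℤ)) v = x})
    (hfm : Measurable f) (hf01 : ∀ σ, 0 ≤ f σ ∧ f σ ≤ 1) :
    |∫ σ, f σ ∂(γ Λ₀ η) - ∫ σ, f σ ∂(γ Λ₀ η')| ≤ ε := by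
  classical
  have hb0 : (0 : ℤ) < (b : ℤ) := by exact_mod_cast hb
  -- the translated grid frame
  let w : Fin 4 → ℤ → ℤ := fun i j => (b : ℤ) * (j + x i)
  have hframe : ∀ i j, w i j + ((b : ℕ) : ℤ) ≤ w i (j + 1) ∧ w i (j + 1) ≤ w i j + 2 * ((b : ℕ) : ℤ) :=
    fun i j => by
      simp only [w]
      constructor <;> nlinarith
  -- its cells are the translated grid cells
  have hmem : ∀ (y : Fin 4 → ℤ) (e : ZdEdge 4),
      e ∈ (Fintype.piFinset fun i : Fin 4 => Finset.Ico (w i (y i)) (w i (y i + 1))) ×ˢ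
        (Finset.univ : Finset (Fin 4)) ↔ (fun i => e.1 i / (b : ℤ)) = y + x := by
    intro y e
    have e1 : ∀ i, w i (y i + 1) = (b : ℤ) * ((y + x) i + 1) := fun i => by
      simp only [w, Pi.add_apply]; ring
    have e2 : ∀ i, w i (y i) = (b : ℤ) * ((y + x) i) := fun i => by
      simp only [w, Pi.add_apply]
    simp only [e1, e2]
    exact mem_gridCell_iff hb0 (y + x) e
  -- the cells met by `Λ₀`, recentred
  set Y : Finset (Fin 4 → ℤ) := Λ₀.image fun v => (fun i => v.1 i / (b : ℤ)) - x with hY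
  have hYsub : Y ⊆ Fintype.piFinset fun _ : Fin 4 =>
      Finset.Icc (-(2 * ((n : ℕ) : ℤ))) (2 * ((n : ℕ) : ℤ)) := by
    intro y hy
    obtain ⟨v, hv, rfl⟩ := Finset.mem_image.1 hy
    rw [Fintype.mem_piFinset]
    intro i
    have h := abs_le.1 (hnear v hv i)
    simp only [Pi.sub_apply]
    exact Finset.mem_Icc.2 ⟨h.1, h.2⟩
  have h0Y : (0 : Fin 4 → ℤ) ∈ Y := by
    refine Finset.mem_image.2 ⟨((fun i => (b : ℤ) * x i), (0 : Fin 4)), hx _ ?_, ?_⟩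
    · funext i
      exact Int.mul_ediv_cancel_left _ hb0.ne'
    · funext i
      simp [Int.mul_ediv_cancel_left _ hb0.ne']
  have hbiU : Y.biUnion (fun y : Fin 4 → ℤ =>
      (Fintype.piFinset fun i : Fin 4 => Finset.Ico (w i (y i)) (w i (y i + 1))) ×ˢ
        (Finset.univ : Finset (Fin 4))) = Λ₀ := by
    ext e
    rw [Finset.mem_biUnion]
    constructor
    · rintro ⟨y, hy, he⟩
      obtain ⟨v, hv, rfl⟩ := Finset.mem_image.1 hy
      rw [hmem, sub_add_cancel] at he
      exact hunion v e he.symm hv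
    · intro he
      refine ⟨(fun i => e.1 i / (b : ℤ)) - x, Finset.mem_image.2 ⟨e, he, rfl⟩, ?_⟩
      rw [hmem, sub_add_cancel]
  have hagree' : ∀ e ∈ (Fintype.piFinset fun _ : Fin 4 =>
      Finset.Icc (-(2 * ((n : ℕ) : ℤ))) (2 * ((n : ℕ) : ℤ))).biUnion (fun y : Fin 4 → ℤ =>
        (Fintype.piFinset fun i : Fin 4 => Finset.Ico (w i (y i)) (w i (y i + 1))) ×ˢ
          (Finset.univ : Finset (Fin 4))), η e = η' e := by
    intro e he
    obtain ⟨y, hy, he⟩ := Finset.mem_biUnion.1 he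
    rw [hmem] at he
    refine hagree e fun i => ?_
    have hyi := Finset.mem_Icc.1 (Fintype.mem_piFinset.1 hy i)
    have hei : e.1 i / (b : ℤ) = y i + x i := congrFun he i
    show |e.1 i / (b : ℤ) - x i| ≤ 2 * n
    rw [hei, add_sub_cancel_right, abs_le]
    exact ⟨hyi.1, hyi.2⟩
  have hcyl : IsCylinder f ((fun y : Fin 4 → ℤ =>
      (Fintype.piFinset fun i : Fin 4 => Finset.Ico (w i (y i)) (w i (y i + 1))) ×ˢ
        (Finset.univ : Finset (Fin 4))) 0) := by
    intro σ σ' h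
    refine hfdep fun v hv => h v ?_
    rw [Finset.mem_coe, hmem, zero_add]
    exact hv
  have key := hFS w hframe Y hYsub h0Y η η' hagree' f hcyl hfm hf01
  rwa [hbiU] at key

end Summit.QuantumFields.YangMills.Theorems.FiniteSizeCriterion

end
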